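import Mathlib
import Summits.NavierStokesRegularity.NavierStokesRegularity.Theorems.PoloidalWindowDoorPoloidalWindowRigidityZShockTurningShearDefinite

/-!
# Crux K2 `PoloidalWindowRigidity` (stmt-NavierStokesRegularity-19708), line `z_shock` — R3 inhabitant census: QUADRATIC SLICES
# WITH AN ARBITRARY STRUCTURE FUNCTION (V) — an INDEFINITE quadratic slice at ONE height forces the structure function to be
# affine on ALL of `ℝ`

`--supports stmt-NavierStokesRegularity-19708 --as helper` (leafhand-ns-poloidalwindowdoor-3 g21, cell decomp-ns, 2026-09-01).  Class-free,
def-free; Mathlib + part III (`…ZShockTurningShearDefinite`, p840033: one-variable kernels).  **No stub and no summit is closed by this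
file; Navier–Stokes regularity is NOT proved here (rung 0).**

Part III treated quadratic slices `W(y) = A + By₀ + Cy₁ + ½(Dy₀² + 2Ey₀y₁ + Gy₁²)` of the autonomous height-evolution
`∂ₛ∂ₛW = γ(W)ΔW + γ'(W)|∇W|²` with a DEFINITE quadratic part; this part does the INDEFINITE non-degenerate case `DG − E² < 0`
(hyperbolic-paraboloid slices), where the conclusion is stronger because the value range is all of `ℝ`:

* `eq_affine_of_deriv_eq_Iio`, `deriv_eq_of_affine_Iic`, `deriv_eq_of_two_rays_neg`, `affine_of_two_sided` — mirror images of part III's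
  kernels on the left half-line, and the gluing of two one-sided affine laws at `m` through differentiability of `γ` at `m`.
* ★ `quadSlice_indef_affine` — **single-height rigidity, indefinite case.**  If `γ` is differentiable and at ONE height the quadratic slice
  with `D ≠ 0`, `DG − E² < 0` satisfies `ℓ(y) = γ(W(y))(D + G) + γ'(W(y))|∇W(y)|²` for all `y` with some quadratic polynomial `ℓ`, then
  `γ` IS AFFINE ON `ℝ`: `γ(t) = γ₀ + 2μt`, `γ'(t) = 2μ` for all `t`.  Proof (for `D > 0`; `D < 0` by `W ↦ −W`, `γ ↦ γ(−·)`): with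
  `S = E² − DG > 0`, `s = √S` and the centre `c` (`∇W(c) = 0`, `m = W(c)`), the rays `y = c ± t·d` carry `W = m + ½t²q_d`, `|∇W|² = t²p_d`
  and the ± sum of the identity gives `(D+G)γ(m+τ) + (2p_d/q_d)τγ'(m+τ) = ℓ(c) + (r_d/q_d)τ` for all `τ` with `τq_d ≥ 0`.  The SPACE-LIKE
  family `d⁺(t) = (S − Et, Dt)` has `q = DS(S − t²) > 0`, `p = S²(D² + (E−t)²)`, the TIME-LIKE family `d⁻(t) = (t − E, D)` has
  `q = D(t² − S) < 0`, `p = D²t² + (Et − S)²` (`|t| < s`); in either family the weight `2p/q` at `t` equals the weight at `0` only if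
  `t((S + D² + E²)t − 2SE) = 0`, so `t₁ ∈ {s/2, s/4}` avoiding the single bad value gives two rays with different weights on EACH side
  of `m`: `γ'` is constant on `(m,∞)` and on `(−∞,m)`, and differentiability at `m` glues the two affine laws into one.
* `quadSlice_indef_affine_swap` — the case `D = 0`, `G ≠ 0` by the symmetry `y₀ ↔ y₁` of the height-evolution.  (Residual, not treated:
  `D = G = 0`, the pure saddle `W = A + B·y + Ey₀y₁`.)
* ★ `quadSlice_indef_TH` — **all heights.**  If a quadratic-slice pattern (data of part II: `D, G ∈ C²`, the rest arbitrary) solves the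
  height-evolution for a differentiable `γ` and its quadratic part is indefinite non-degenerate with `D ≠ 0 ∨ G ≠ 0` at ONE height, then
  `γ' ≡ 0` on ALL of `ℝ` (the structure function is constant: linearly degenerate column).  For then `γ` is globally affine, the hypothesis
  is part II's `hpde` verbatim, and `quadSlice_flat_of_affine_thick` (p839549) forces `D ≡ E ≡ G ≡ 0` unless `μ = 0` — contradicting
  indefiniteness at that height.

With parts III–IV: a quadratic-slice pattern on the THICK column (for ANY differentiable `γ` with `γ' ≢ 0` on the attained values) has, at
every height, a quadratic part that is semi-definite; if it is definite at every height the pattern is (TH) (part IV); the rank-one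
heights and the pure saddle `D = G = 0` are the named residue of the quadratic family.  Honest scope: toy sub-family of R3 (`hGN` stays
XL, not in print); kinematic (no NS); the substitution of the ansatz is the displayed identity, taken as hypothesis.  presearch: as part
III (nothing in print for a general structure function; crux records: parts I–IV only). [folklore]
-/

noncomputable section

namespace Summit.NavierStokesRegularity.NavierStokesRegularity.Theorems.PoloidalWindowDoorPoloidalWindowRigidityZShockTurningShearIndefinite

-- the summit and its single sub-problem share the name (CONVENTIONS §1)
set_option linter.dupNamespace false

open Set Filter Topology
open Summit.NavierStokesRegularity.NavierStokesRegularity.Theorems.PoloidalWindowDoorPoloidalWindowRigidityZShockTurningShearQuadratic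
open Summit.NavierStokesRegularity.NavierStokesRegularity.Theorems.PoloidalWindowDoorPoloidalWindowRigidityZShockTurningShearDefinite

/-! ## One-variable kernels on the left half-line and the two-sided gluing -/

/-- **Constant derivative on an open left half-line ⇒ affine on the closed left half-line** (mean value theorem on `[m − τ, m]`).
[folklore] -/
theorem eq_affine_of_deriv_eq_Iio {γ γ' : ℝ → ℝ} {m k : ℝ} (hγ : ∀ t, HasDerivAt γ (γ' t) t)
    (hk : ∀ τ, 0 < τ → γ' (m - τ) = k) : ∀ τ, 0 ≤ τ → γ (m - τ) = γ m - k * τ := by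
  intro τ hτ
  rcases hτ.eq_or_lt with h | hτpos
  · rw [← h, sub_zero, mul_zero, sub_zero]
  · have hφ : ∀ t, HasDerivAt (fun t => γ t - k * t) (γ' t - k) t := fun t =>
      (hγ t).fun_sub (hasDerivAt_const_mul k)
    obtain ⟨ξ, hξ, hslope⟩ := exists_hasDerivAt_eq_slope (fun t => γ t - k * t) (fun t => γ' t - k)
      (by linarith : m - τ < m) (fun t _ => (hφ t).continuousAt.continuousWithinAt) (fun t _ => hφ t)
    have h1 : γ' ξ = k := by
      have h2 := hk (m - ξ) (by linarith [hξ.2])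
      have h3 : m - (m - ξ) = ξ := by ring
      rwa [h3] at h2
    rw [h1, sub_self] at hslope
    have hne : m - (m - τ) ≠ 0 := by linarith
    have h3 : γ m - k * m - (γ (m - τ) - k * (m - τ)) = 0 := by
      rcases (div_eq_zero_iff.mp hslope.symm) with h | h
      · exact h
      · exact absurd h hne
    linarith

/-- **One-sided uniqueness of the derivative, from the left.**  If `γ` is differentiable at `t₀` and affine with slope `k` on
`(−∞, t₀]`, then `γ'(t₀) = k`. [folklore] -/
theorem deriv_eq_of_affine_Iic {γ γ' : ℝ → ℝ} {t₀ γ₀ k : ℝ} (hγ : HasDerivAt γ (γ' t₀) t₀)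
    (h : ∀ τ, 0 ≤ τ → γ (t₀ - τ) = γ₀ - k * τ) : γ' t₀ = k := by
  have h1 : HasDerivWithinAt γ (γ' t₀) (Iic t₀) t₀ := hγ.hasDerivWithinAt
  have h2 : HasDerivAt (fun t => γ₀ + k * (t - t₀)) k t₀ := by
    have h := (((hasDerivAt_id t₀).sub_const t₀).const_mul k).const_add γ₀
    simpa using h
  have h3 : HasDerivWithinAt γ k (Iic t₀) t₀ := by
    refine h2.hasDerivWithinAt.congr_of_mem (fun t ht => ?_) self_mem_Iic
    have h4 := h (t₀ - t) (by simpa [sub_nonneg] using ht)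
    have h5 : t₀ - (t₀ - t) = t := by ring
    rw [h5] at h4
    rw [h4]; ring
  exact (uniqueDiffOn_Iic t₀ t₀ self_mem_Iic).eq_deriv _ h1 h3

/-- **Two ray identities with different weights on the left half-line pin the derivative** (mirror of part III's
`deriv_eq_of_two_rays`). [folklore] -/
theorem deriv_eq_of_two_rays_neg {γ γ' : ℝ → ℝ} {m T l σ₁ σ₂ ρ₁ ρ₂ : ℝ} (hσ : σ₁ ≠ σ₂)
    (h₁ : ∀ τ, τ ≤ 0 → T * γ (m + τ) + σ₁ * τ * γ' (m + τ) = l + ρ₁ * τ)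
    (h₂ : ∀ τ, τ ≤ 0 → T * γ (m + τ) + σ₂ * τ * γ' (m + τ) = l + ρ₂ * τ) :
    ∀ τ, τ < 0 → γ' (m + τ) = (ρ₁ - ρ₂) / (σ₁ - σ₂) := by
  intro τ hτ
  have e1 := h₁ τ hτ.le
  have e2 := h₂ τ hτ.le
  have hne : σ₁ - σ₂ ≠ 0 := sub_ne_zero.mpr hσ
  have h3 : (σ₁ - σ₂) * τ * γ' (m + τ) = (ρ₁ - ρ₂) * τ := by linear_combination e1 - e2
  rw [eq_div_iff hne]
  have hτne : τ ≠ 0 := hτ.ne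
  have h4 : τ * (γ' (m + τ) * (σ₁ - σ₂) - (ρ₁ - ρ₂)) = 0 := by linear_combination h3
  rcases mul_eq_zero.mp h4 with h5 | h5
  · exact absurd h5 hτne
  · linear_combination h5

/-- **Gluing two one-sided affine laws.**  If `γ` is differentiable on `ℝ`, `γ' = kR` on `(m, ∞)` and `γ' = kL` on `(−∞, m)`, then
`kR = kL = γ'(m)` and `γ` is affine on all of `ℝ`: `γ(t) = γ₀ + 2μt`, `γ'(t) = 2μ`. [folklore] -/
theorem affine_of_two_sided {γ γ' : ℝ → ℝ} {m kR kL : ℝ} (hγ : ∀ t, HasDerivAt γ (γ' t) t)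
    (hR' : ∀ τ, 0 < τ → γ' (m + τ) = kR) (hL' : ∀ τ, 0 < τ → γ' (m - τ) = kL) :
    ∃ γ₀ μ : ℝ, (∀ t, γ t = γ₀ + 2 * μ * t) ∧ (∀ t, γ' t = 2 * μ) := by
  have hRa := eq_affine_of_deriv_eq_Ioi hγ hR'
  have hLa := eq_affine_of_deriv_eq_Iio hγ hL'
  have hkR : γ' m = kR := deriv_eq_of_affine_Ici (hγ m) (γ₀ := γ m) hRa
  have hkL : γ' m = kL := deriv_eq_of_affine_Iic (hγ m) (γ₀ := γ m) hLa
  refine ⟨γ m - kR * m, kR / 2, fun t => ?_, fun t => ?_⟩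
  · rcases le_or_gt m t with h | h
    · have h1 := hRa (t - m) (by linarith)
      have h2 : m + (t - m) = t := by ring
      rw [h2] at h1
      rw [h1]; ring
    · have h1 := hLa (m - t) (by linarith)
      have h2 : m - (m - t) = t := by ring
      rw [h2] at h1
      rw [h1, ← hkL, hkR]; ring
  · rcases lt_trichotomy m t with h | h | h
    · have h1 := hR' (t - m) (by linarith)
      have h2 : m + (t - m) = t := by ring
      rw [h2] at h1
      rw [h1]; ring
    · rw [← h, hkR]; ring
    · have h1 := hL' (m - t) (by linarith)
      have h2 : m - (m - t) = t := by ring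
      rw [h2] at h1
      rw [h1, ← hkL, hkR]; ring

/-! ## Single-height rigidity for an indefinite quadratic slice -/

/-- ★ **An indefinite quadratic slice at ONE height makes the structure function affine on `ℝ`** — core case `D > 0`.  Let `γ` be
differentiable with derivative `γ'`, and let the quadratic slice `W(y) = A + By₀ + Cy₁ + ½(Dy₀² + 2Ey₀y₁ + Gy₁²)` with `D > 0`,
`DG − E² < 0` satisfy `ℓ(y) = γ(W(y))(D + G) + γ'(W(y))·P(y)` for all `y`, where `P = |∇W|²` and `ℓ` is any quadratic polynomial.
Then `γ(t) = γ₀ + 2μt` and `γ'(t) = 2μ` for all real `t` (space-like and time-like ray families from the centre, two weights on each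
side of `m = W(c)`, gluing at `m` — see the module docstring). [folklore] -/
theorem quadSlice_indef_affine_pos {γ γ' : ℝ → ℝ} (hγ : ∀ t, HasDerivAt γ (γ' t) t)
    {A B C D E G a b c d e g : ℝ} {W P ℓ : ℝ → ℝ → ℝ}
    (hW : ∀ y₀ y₁, W y₀ y₁ = A + B * y₀ + C * y₁ + (D * y₀ ^ 2 + 2 * E * y₀ * y₁ + G * y₁ ^ 2) / 2)
    (hP : ∀ y₀ y₁, P y₀ y₁ = (B + D * y₀ + E * y₁) ^ 2 + (C + E * y₀ + G * y₁) ^ 2)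
    (hℓ : ∀ y₀ y₁, ℓ y₀ y₁ = a + b * y₀ + c * y₁ + (d * y₀ ^ 2 + 2 * e * y₀ * y₁ + g * y₁ ^ 2) / 2)
    (hD : 0 < D) (hdet : D * G - E ^ 2 < 0)
    (hpde : ∀ y₀ y₁, ℓ y₀ y₁ = γ (W y₀ y₁) * (D + G) + γ' (W y₀ y₁) * P y₀ y₁) :
    ∃ γ₀ μ : ℝ, (∀ t, γ t = γ₀ + 2 * μ * t) ∧ (∀ t, γ' t = 2 * μ) := by
  -- the discriminant `S = E² − DG > 0` and its square root
  obtain ⟨S, hS, hSpos⟩ : ∃ S : ℝ, S = E ^ 2 - D * G ∧ 0 < S := ⟨_, rfl, by linarith⟩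
  set s := Real.sqrt S with hs_def
  have hs2 : s ^ 2 = S := by rw [hs_def, Real.sq_sqrt hSpos.le]
  have hs : 0 < s := Real.sqrt_pos.mpr hSpos
  have hδ : D * G - E ^ 2 ≠ 0 := hdet.ne
  have hδ' : G * D - E ^ 2 ≠ 0 := by rw [mul_comm]; exact hδ
  -- the centre `c` of the slice: `∇W(c) = 0`
  obtain ⟨c₀, c₁, hcen₀, hcen₁⟩ : ∃ c₀ c₁ : ℝ, B + D * c₀ + E * c₁ = 0 ∧ C + E * c₀ + G * c₁ = 0 := by
    refine ⟨(E * C - G * B) / (D * G - E ^ 2), (E * B - D * C) / (D * G - E ^ 2), ?_, ?_⟩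
    · field_simp; ring
    · field_simp; ring
  set m := W c₀ c₁ with hm
  -- expansions along the rays `y = c + t·d`
  have hWray : ∀ t d₀ d₁ : ℝ, W (c₀ + t * d₀) (c₁ + t * d₁) =
      m + t ^ 2 * (D * d₀ ^ 2 + 2 * E * d₀ * d₁ + G * d₁ ^ 2) / 2 := by
    intro t d₀ d₁
    rw [hW, hm, hW]
    linear_combination (t * d₀) * hcen₀ + (t * d₁) * hcen₁
  have hPray : ∀ t d₀ d₁ : ℝ, P (c₀ + t * d₀) (c₁ + t * d₁) =
      t ^ 2 * ((D * d₀ + E * d₁) ^ 2 + (E * d₀ + G * d₁) ^ 2) := by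
    intro t d₀ d₁
    rw [hP]
    have h1 : B + D * (c₀ + t * d₀) + E * (c₁ + t * d₁) = t * (D * d₀ + E * d₁) := by linear_combination hcen₀
    have h2 : C + E * (c₀ + t * d₀) + G * (c₁ + t * d₁) = t * (E * d₀ + G * d₁) := by linear_combination hcen₁
    rw [h1, h2]; ring
  have hℓray : ∀ t d₀ d₁ : ℝ, ℓ (c₀ + t * d₀) (c₁ + t * d₁) + ℓ (c₀ + (-t) * d₀) (c₁ + (-t) * d₁) =
      2 * ℓ c₀ c₁ + t ^ 2 * (d * d₀ ^ 2 + 2 * e * d₀ * d₁ + g * d₁ ^ 2) := by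
    intro t d₀ d₁
    rw [hℓ, hℓ, hℓ]; ring
  -- the RAY IDENTITY on either side: `τ q_d ≥ 0`
  have ray : ∀ d₀ d₁ q p r : ℝ, q = D * d₀ ^ 2 + 2 * E * d₀ * d₁ + G * d₁ ^ 2 →
      p = (D * d₀ + E * d₁) ^ 2 + (E * d₀ + G * d₁) ^ 2 → r = d * d₀ ^ 2 + 2 * e * d₀ * d₁ + g * d₁ ^ 2 →
      q ≠ 0 → ∀ τ, 0 ≤ 2 * τ / q →
      (D + G) * γ (m + τ) + (2 * p / q) * τ * γ' (m + τ) = ℓ c₀ c₁ + (r / q) * τ := by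
    intro d₀ d₁ q p r hq hp hr hqne τ hτ
    set t := Real.sqrt (2 * τ / q) with ht
    have ht2 : t ^ 2 = 2 * τ / q := by rw [ht, Real.sq_sqrt hτ]
    have hnt2 : (-t) ^ 2 = 2 * τ / q := by rw [neg_sq, ht2]
    have hWp : W (c₀ + t * d₀) (c₁ + t * d₁) = m + τ := by
      rw [hWray, ← hq, ht2]; field_simp
    have hWn : W (c₀ + (-t) * d₀) (c₁ + (-t) * d₁) = m + τ := by
      rw [hWray, ← hq, hnt2]; field_simp
    have hPp : P (c₀ + t * d₀) (c₁ + t * d₁) = 2 * τ / q * p := by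
      rw [hPray, ← hp, ht2]
    have hPn : P (c₀ + (-t) * d₀) (c₁ + (-t) * d₁) = 2 * τ / q * p := by
      rw [hPray, ← hp, hnt2]
    have h1 := hpde (c₀ + t * d₀) (c₁ + t * d₁)
    have h2 := hpde (c₀ + (-t) * d₀) (c₁ + (-t) * d₁)
    have h3 := hℓray t d₀ d₁
    rw [hWp, hPp] at h1
    rw [hWn, hPn] at h2
    rw [← hr, ht2] at h3
    linear_combination (h3 - h1 - h2) / 2
  -- closed forms along the space-like family `d⁺(t) = (S − Et, Dt)` and the time-like family `d⁻(t) = (t − E, D)`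
  have hq_pos : ∀ t, D * (S - E * t) ^ 2 + 2 * E * (S - E * t) * (D * t) + G * (D * t) ^ 2 = D * S * (S - t ^ 2) := by
    intro t; linear_combination (D * t ^ 2) * hS
  have hp_pos : ∀ t, (D * (S - E * t) + E * (D * t)) ^ 2 + (E * (S - E * t) + G * (D * t)) ^ 2 =
      S ^ 2 * (D ^ 2 + (E - t) ^ 2) := by
    intro t; linear_combination (t * (2 * E * S - E ^ 2 * t + G * D * t - S * t)) * hS
  have hq_neg : ∀ t, D * (t - E) ^ 2 + 2 * E * (t - E) * D + G * D ^ 2 = D * (t ^ 2 - S) := by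
    intro t; linear_combination D * hS
  have hp_neg : ∀ t, (D * (t - E) + E * D) ^ 2 + (E * (t - E) + G * D) ^ 2 = D ^ 2 * t ^ 2 + (E * t - S) ^ 2 := by
    intro t; linear_combination (2 * E * t - E ^ 2 + G * D - S) * hS
  -- the ray identities of the two families, for `|t| < s`, in closed form
  have rayP : ∀ t, t ^ 2 < S → ∀ τ, 0 ≤ τ →
      (D + G) * γ (m + τ) + (2 * (S ^ 2 * (D ^ 2 + (E - t) ^ 2)) / (D * S * (S - t ^ 2))) * τ * γ' (m + τ) =
        ℓ c₀ c₁ + ((d * (S - E * t) ^ 2 + 2 * e * (S - E * t) * (D * t) + g * (D * t) ^ 2) / (D * S * (S - t ^ 2))) * τ := by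
    intro t ht τ hτ
    have hqpos : 0 < D * S * (S - t ^ 2) := by
      have : 0 < S - t ^ 2 := by linarith
      positivity
    exact ray (S - E * t) (D * t) (D * S * (S - t ^ 2)) (S ^ 2 * (D ^ 2 + (E - t) ^ 2)) _
      (hq_pos t).symm (hp_pos t).symm rfl hqpos.ne' τ (div_nonneg (by linarith) hqpos.le)
  have rayN : ∀ t, t ^ 2 < S → ∀ τ, τ ≤ 0 →
      (D + G) * γ (m + τ) + (2 * (D ^ 2 * t ^ 2 + (E * t - S) ^ 2) / (D * (t ^ 2 - S))) * τ * γ' (m + τ) =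
        ℓ c₀ c₁ + ((d * (t - E) ^ 2 + 2 * e * (t - E) * D + g * D ^ 2) / (D * (t ^ 2 - S))) * τ := by
    intro t ht τ hτ
    have hqneg : D * (t ^ 2 - S) < 0 := by
      have : t ^ 2 - S < 0 := by linarith
      exact mul_neg_of_pos_of_neg hD this
    refine ray (t - E) D (D * (t ^ 2 - S)) (D ^ 2 * t ^ 2 + (E * t - S) ^ 2) _
      (hq_neg t).symm (hp_neg t).symm rfl hqneg.ne τ ?_
    exact div_nonneg_of_nonpos (by linarith) hqneg.le
  -- when do two weights of one family coincide?  only at `t = 0` or at the single value `t⋆ = 2SE/(S + D² + E²)`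
  have hK : 0 < S + D ^ 2 + E ^ 2 := by positivity
  have weightP : ∀ t, t ^ 2 < S →
      2 * (S ^ 2 * (D ^ 2 + (E - t) ^ 2)) / (D * S * (S - t ^ 2)) = 2 * (S ^ 2 * (D ^ 2 + (E - 0) ^ 2)) / (D * S * (S - 0 ^ 2)) →
      t * ((S + D ^ 2 + E ^ 2) * t - 2 * S * E) = 0 := by
    intro t ht h
    have h1 : D * S * (S - t ^ 2) ≠ 0 := by
      have : 0 < S - t ^ 2 := by linarith
      positivity
    have h2 : D * S * (S - 0 ^ 2) ≠ 0 := by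
      have h0 : (S - (0:ℝ) ^ 2) = S := by ring
      rw [h0]; positivity
    rw [div_eq_div_iff h1 h2] at h
    have h3 : D * S ^ 3 * (t * ((S + D ^ 2 + E ^ 2) * t - 2 * S * E)) = 0 := by linear_combination (1 / 2 : ℝ) * h
    have h4 : D * S ^ 3 ≠ 0 := by positivity
    rcases mul_eq_zero.mp h3 with h5 | h5
    · exact absurd h5 h4
    · exact h5
  have weightN : ∀ t, t ^ 2 < S →
      2 * (D ^ 2 * t ^ 2 + (E * t - S) ^ 2) / (D * (t ^ 2 - S)) = 2 * (D ^ 2 * 0 ^ 2 + (E * 0 - S) ^ 2) / (D * (0 ^ 2 - S)) →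
      t * ((S + D ^ 2 + E ^ 2) * t - 2 * S * E) = 0 := by
    intro t ht h
    have h1 : D * (t ^ 2 - S) ≠ 0 := by
      have : t ^ 2 - S < 0 := by linarith
      exact (mul_neg_of_pos_of_neg hD this).ne
    have h2 : D * (0 ^ 2 - S) ≠ 0 := by
      have : (0:ℝ) ^ 2 - S < 0 := by linarith
      exact (mul_neg_of_pos_of_neg hD this).ne
    rw [div_eq_div_iff h1 h2] at h
    have h3 : D * S * (t * ((S + D ^ 2 + E ^ 2) * t - 2 * S * E)) = 0 := by linear_combination (-1 / 2 : ℝ) * h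
    have h4 : D * S ≠ 0 := by positivity
    rcases mul_eq_zero.mp h3 with h5 | h5
    · exact absurd h5 h4
    · exact h5
  -- a good parameter `t₁ ∈ {s/2, s/4}`: nonzero, `t₁² < S`, and not the bad value
  obtain ⟨t₁, ht₁ne, ht₁S, ht₁good⟩ : ∃ t₁ : ℝ, t₁ ≠ 0 ∧ t₁ ^ 2 < S ∧ (S + D ^ 2 + E ^ 2) * t₁ - 2 * S * E ≠ 0 := by
    by_cases hbad : (S + D ^ 2 + E ^ 2) * (s / 2) - 2 * S * E = 0
    · refine ⟨s / 4, by positivity, by nlinarith, ?_⟩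
      intro h
      have h1 : (S + D ^ 2 + E ^ 2) * s = 0 := by linear_combination 4 * hbad - 4 * h
      have h2 : (S + D ^ 2 + E ^ 2) * s ≠ 0 := by positivity
      exact h2 h1
    · exact ⟨s / 2, by positivity, by nlinarith, hbad⟩
  have ht₁prod : t₁ * ((S + D ^ 2 + E ^ 2) * t₁ - 2 * S * E) ≠ 0 := mul_ne_zero ht₁ne ht₁good
  have h0S : (0:ℝ) ^ 2 < S := by simpa using hSpos
  -- right half-line: two space-like rays
  have hσP : 2 * (S ^ 2 * (D ^ 2 + (E - t₁) ^ 2)) / (D * S * (S - t₁ ^ 2)) ≠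
      2 * (S ^ 2 * (D ^ 2 + (E - 0) ^ 2)) / (D * S * (S - 0 ^ 2)) := fun h => ht₁prod (weightP t₁ ht₁S h)
  have hkP := deriv_eq_of_two_rays hσP (rayP t₁ ht₁S) (rayP 0 h0S)
  -- left half-line: two time-like rays
  have hσN : 2 * (D ^ 2 * t₁ ^ 2 + (E * t₁ - S) ^ 2) / (D * (t₁ ^ 2 - S)) ≠
      2 * (D ^ 2 * 0 ^ 2 + (E * 0 - S) ^ 2) / (D * (0 ^ 2 - S)) := fun h => ht₁prod (weightN t₁ ht₁S h)
  have hkN := deriv_eq_of_two_rays_neg hσN (rayN t₁ ht₁S) (rayN 0 h0S)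
  -- glue
  exact affine_of_two_sided hγ hkP (fun τ hτ => by
    have h1 := hkN (-τ) (by linarith)
    rwa [← sub_eq_add_neg] at h1)

/-- ★ **An indefinite quadratic slice at ONE height makes the structure function affine on `ℝ`** — `D ≠ 0` (the case `D < 0` by
the symmetry `W ↦ −W`, `γ ↦ γ(−·)`, `ℓ ↦ −ℓ` of the height-evolution, reduced to `quadSlice_indef_affine_pos`). [folklore] -/
theorem quadSlice_indef_affine {γ γ' : ℝ → ℝ} (hγ : ∀ t, HasDerivAt γ (γ' t) t)
    {A B C D E G a b c d e g : ℝ} {W P ℓ : ℝ → ℝ → ℝ}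
    (hW : ∀ y₀ y₁, W y₀ y₁ = A + B * y₀ + C * y₁ + (D * y₀ ^ 2 + 2 * E * y₀ * y₁ + G * y₁ ^ 2) / 2)
    (hP : ∀ y₀ y₁, P y₀ y₁ = (B + D * y₀ + E * y₁) ^ 2 + (C + E * y₀ + G * y₁) ^ 2)
    (hℓ : ∀ y₀ y₁, ℓ y₀ y₁ = a + b * y₀ + c * y₁ + (d * y₀ ^ 2 + 2 * e * y₀ * y₁ + g * y₁ ^ 2) / 2)
    (hD : D ≠ 0) (hdet : D * G - E ^ 2 < 0)
    (hpde : ∀ y₀ y₁, ℓ y₀ y₁ = γ (W y₀ y₁) * (D + G) + γ' (W y₀ y₁) * P y₀ y₁) :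
    ∃ γ₀ μ : ℝ, (∀ t, γ t = γ₀ + 2 * μ * t) ∧ (∀ t, γ' t = 2 * μ) := by
  rcases lt_or_gt_of_ne hD with hneg | hpos
  · -- reflect: `W ↦ −W`, `γ ↦ γ(−·)`
    have hγn : ∀ t, HasDerivAt (fun t => γ (-t)) (-γ' (-t)) t := by
      intro t
      have h := (hγ (-t)).comp t (hasDerivAt_neg t)
      simpa [Function.comp_def] using h
    obtain ⟨γ₀, μ, h1, h2⟩ := quadSlice_indef_affine_pos hγn
      (A := -A) (B := -B) (C := -C) (D := -D) (E := -E) (G := -G) (a := -a) (b := -b) (c := -c) (d := -d) (e := -e)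
      (g := -g) (W := fun y₀ y₁ => -W y₀ y₁) (P := P) (ℓ := fun y₀ y₁ => -ℓ y₀ y₁)
      (fun y₀ y₁ => by rw [hW]; ring) (fun y₀ y₁ => by rw [hP]; ring) (fun y₀ y₁ => by rw [hℓ]; ring)
      (by linarith) (by nlinarith) (fun y₀ y₁ => by
        have h := hpde y₀ y₁
        simp only [neg_neg]
        linear_combination (-1 : ℝ) * h)
    refine ⟨γ₀, -μ, fun t => ?_, fun t => ?_⟩
    · have h3 := h1 (-t)
      simp only [neg_neg] at h3
      rw [h3]; ring
    · have h3 := h2 (-t)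
      simp only [neg_neg] at h3
      linarith
  · exact quadSlice_indef_affine_pos hγ hW hP hℓ hpos hdet hpde

/-- **The case `D = 0`, `G ≠ 0`** by the symmetry `y₀ ↔ y₁` of the height-evolution (reduced to `quadSlice_indef_affine`).  Together:
an indefinite non-degenerate quadratic slice with `D ≠ 0 ∨ G ≠ 0` at one height makes `γ` affine on `ℝ`. [folklore] -/
theorem quadSlice_indef_affine_swap {γ γ' : ℝ → ℝ} (hγ : ∀ t, HasDerivAt γ (γ' t) t)
    {A B C D E G a b c d e g : ℝ} {W P ℓ : ℝ → ℝ → ℝ}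
    (hW : ∀ y₀ y₁, W y₀ y₁ = A + B * y₀ + C * y₁ + (D * y₀ ^ 2 + 2 * E * y₀ * y₁ + G * y₁ ^ 2) / 2)
    (hP : ∀ y₀ y₁, P y₀ y₁ = (B + D * y₀ + E * y₁) ^ 2 + (C + E * y₀ + G * y₁) ^ 2)
    (hℓ : ∀ y₀ y₁, ℓ y₀ y₁ = a + b * y₀ + c * y₁ + (d * y₀ ^ 2 + 2 * e * y₀ * y₁ + g * y₁ ^ 2) / 2)
    (hDG : D ≠ 0 ∨ G ≠ 0) (hdet : D * G - E ^ 2 < 0)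
    (hpde : ∀ y₀ y₁, ℓ y₀ y₁ = γ (W y₀ y₁) * (D + G) + γ' (W y₀ y₁) * P y₀ y₁) :
    ∃ γ₀ μ : ℝ, (∀ t, γ t = γ₀ + 2 * μ * t) ∧ (∀ t, γ' t = 2 * μ) := by
  rcases hDG with hD | hG
  · exact quadSlice_indef_affine hγ hW hP hℓ hD hdet hpde
  · exact quadSlice_indef_affine hγ (A := A) (B := C) (C := B) (D := G) (E := E) (G := D) (a := a) (b := c) (c := b)
      (d := g) (e := e) (g := d) (W := fun y₀ y₁ => W y₁ y₀) (P := fun y₀ y₁ => P y₁ y₀) (ℓ := fun y₀ y₁ => ℓ y₁ y₀)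
      (fun y₀ y₁ => by rw [hW]; ring) (fun y₀ y₁ => by rw [hP]; ring) (fun y₀ y₁ => by rw [hℓ]; ring)
      hG (by linarith) (fun y₀ y₁ => by rw [hpde, add_comm D G])

/-! ## All heights: an indefinite height forces the linearly degenerate column -/

/-- ★ **One indefinite height ⇒ (TH).**  Let `γ` be differentiable (derivative `γ'`), `D, G ∈ C²(ℝ)`, the other coefficients arbitrary
real functions (the data of part II), and let the quadratic-slice pattern satisfy the height-evolution (`hpde`) at every height.  If at
ONE height `z₀` the quadratic part is indefinite and non-degenerate (`D(z₀)G(z₀) − E(z₀)² < 0`) with `D(z₀) ≠ 0 ∨ G(z₀) ≠ 0`, then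
`γ' ≡ 0` on `ℝ`: the structure function is constant.  (`quadSlice_indef_affine_swap` makes `γ` globally affine, so part II's
`quadSlice_flat_of_affine_thick` applies verbatim and would force `D ≡ E ≡ G ≡ 0` for `μ ≠ 0`.) [folklore] -/
theorem quadSlice_indef_TH {A B C D E G A'' B'' C'' D' G' D'' E'' G'' γ γ' : ℝ → ℝ}
    (hγ : ∀ t, HasDerivAt γ (γ' t) t)
    (hD : ∀ z, HasDerivAt D (D' z) z) (hD' : ∀ z, HasDerivAt D' (D'' z) z)
    (hG : ∀ z, HasDerivAt G (G' z) z) (hG' : ∀ z, HasDerivAt G' (G'' z) z)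
    {z₀ : ℝ} (hindef : D z₀ * G z₀ - E z₀ ^ 2 < 0) (hDG : D z₀ ≠ 0 ∨ G z₀ ≠ 0)
    (hpde : ∀ z y₀ y₁ : ℝ,
      A'' z + B'' z * y₀ + C'' z * y₁ + (D'' z * y₀ ^ 2 + 2 * E'' z * y₀ * y₁ + G'' z * y₁ ^ 2) / 2 =
        γ (A z + B z * y₀ + C z * y₁ + (D z * y₀ ^ 2 + 2 * E z * y₀ * y₁ + G z * y₁ ^ 2) / 2) * (D z + G z) +
          γ' (A z + B z * y₀ + C z * y₁ + (D z * y₀ ^ 2 + 2 * E z * y₀ * y₁ + G z * y₁ ^ 2) / 2) *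
            ((B z + D z * y₀ + E z * y₁) ^ 2 + (C z + E z * y₀ + G z * y₁) ^ 2)) :
    ∀ t, γ' t = 0 := by
  obtain ⟨γ₀, μ, hγaff, hγ'⟩ := quadSlice_indef_affine_swap hγ
    (W := fun y₀ y₁ => A z₀ + B z₀ * y₀ + C z₀ * y₁ + (D z₀ * y₀ ^ 2 + 2 * E z₀ * y₀ * y₁ + G z₀ * y₁ ^ 2) / 2)
    (P := fun y₀ y₁ => (B z₀ + D z₀ * y₀ + E z₀ * y₁) ^ 2 + (C z₀ + E z₀ * y₀ + G z₀ * y₁) ^ 2)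
    (ℓ := fun y₀ y₁ => A'' z₀ + B'' z₀ * y₀ + C'' z₀ * y₁ + (D'' z₀ * y₀ ^ 2 + 2 * E'' z₀ * y₀ * y₁ + G'' z₀ * y₁ ^ 2) / 2)
    (fun _ _ => rfl) (fun _ _ => rfl) (fun _ _ => rfl) hDG hindef (fun y₀ y₁ => hpde z₀ y₀ y₁)
  have hpde' : ∀ z y₀ y₁ : ℝ,
      A'' z + B'' z * y₀ + C'' z * y₁ + (D'' z * y₀ ^ 2 + 2 * E'' z * y₀ * y₁ + G'' z * y₁ ^ 2) / 2 =
        (γ₀ + 2 * μ * (A z + B z * y₀ + C z * y₁ + (D z * y₀ ^ 2 + 2 * E z * y₀ * y₁ + G z * y₁ ^ 2) / 2)) *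
            (D z + G z) +
          2 * μ * ((B z + D z * y₀ + E z * y₁) ^ 2 + (C z + E z * y₀ + G z * y₁) ^ 2) := by
    intro z y₀ y₁
    rw [hpde z y₀ y₁, hγaff, hγ']
  have hμ0 : μ = 0 := by
    by_contra hne
    have h1 := quadSlice_flat_of_affine_thick hne hD hD' hG hG' hpde' z₀
    rcases hDG with h | h
    · exact h h1.1
    · exact h h1.2.2
  intro t
  rw [hγ' t, hμ0, mul_zero]

end Summit.NavierStokesRegularity.NavierStokesRegularity.Theorems.PoloidalWindowDoorPoloidalWindowRigidityZShockTurningShearIndefinite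

end
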